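import Mathlib
import Literature.Analysis.PDE.SingleEntropy.PotentialEstimates
import HarnessLib

/-!
# A Lipschitz potential `h` with `(hₜ, hₓ) = (-f(u), u)` for a distributional solution

Topic `Literature/Analysis/PDE/SingleEntropy` — part of the formalization of
De Lellis–Otto–Westdickenberg, *Minimal entropy conditions for Burgers equation*, Quart. Appl.
Math. 62 (2004) 687–700, Thm 2.3 / Cor 2.5 (the named fact
`Literature.Analysis.PDE.deLellisOttoWestdickenberg_singleEntropy`).

`exists_potential`: if `uₜ + f(u)ₓ = 0` in `𝒟'(Ω)` with `u ∈ L^∞` and `closedBall p₀ (2R) ⊆ Ω`,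
there is a bounded, globally Lipschitz `h : ℝ² → ℝ` which is differentiable with
`∂ₜh = -f(u)`, `∂ₓh = u` at a.e. point of `ball p₀ (R/2)` — the function "`h` with `hₜ = -f(u)` and
`hₓ = u`" of De Lellis–Otto–Westdickenberg 2004, Thm 2.3. Construction: potentials of the mollified
fields (uniformly Cauchy by `abs_sub_le_of_mollify_comm`), McShane extension and clamping;
identification of the a.e. gradient through integration by parts, Rademacher's theorem and the
du Bois-Reymond lemma. [folklore]
-/

noncomputable section

open MeasureTheory Set Filter Metric ContinuousLinearMap
open scoped Topology Convolution NNReal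

namespace Literature.Analysis.PDE.SingleEntropy

variable (ρ : ContDiffBump (0 : ℝ × ℝ))

section PotentialConstruction

open scoped NNReal

/-- Mollification commutes with negation. [folklore] -/
theorem mollify_neg (g : ℝ × ℝ → ℝ) (z : ℝ × ℝ) :
    (ρ.normed volume ⋆[lsmul ℝ ℝ, volume] (fun y => -g y)) z
      = -(ρ.normed volume ⋆[lsmul ℝ ℝ, volume] g) z := by
  rw [mollify_apply, mollify_apply, ← integral_neg]
  congr 1; funext y; ring

/-- Integration by parts against a test function for a continuous function with continuous line
derivative on a neighbourhood of the support. [folklore] -/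
theorem integral_mul_fderiv_eq_of_hasLineDerivAt {P W φ : ℝ × ℝ → ℝ} (hP : Continuous P)
    (hW : Continuous W) (hφ : ContDiff ℝ (⊤ : ℕ∞) φ) (hφc : HasCompactSupport φ) {v : ℝ × ℝ}
    (hline : ∀ y ∈ tsupport φ, HasLineDerivAt ℝ P (W y) y v) :
    ∫ z, P z * fderiv ℝ φ z v = -∫ z, W z * φ z := by
  have hφ1 : ContDiff ℝ 1 φ := hφ.of_le (by simp)
  have cφv : Continuous fun z => fderiv ℝ φ z v :=
    (hφ1.continuous_fderiv one_ne_zero).clm_apply continuous_const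
  have key := integral_bilinear_hasLineDerivAt_right_eq_neg_left_of_integrable
    (μ := volume) (B := ContinuousLinearMap.mul ℝ ℝ) (f := P) (f' := W) (g := φ)
    (g' := fun z => fderiv ℝ φ z v) (v := v) ?_ ?_ ?_ hline
    (fun y _ => ((hφ1.differentiable one_ne_zero) y).hasFDerivAt.hasLineDerivAt v)
  · simpa only [ContinuousLinearMap.mul_apply'] using key
  · simp only [ContinuousLinearMap.mul_apply']
    exact (hW.mul hφ.continuous).integrable_of_hasCompactSupport
      (hφc.mono (fun x hx => by intro h0; exact hx (by simp [h0])))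
  · simp only [ContinuousLinearMap.mul_apply']
    exact (hP.mul cφv).integrable_of_hasCompactSupport
      ((hφc.fderiv_apply ℝ v).mono (fun x hx => by
        intro h0
        apply hx
        show P x * fderiv ℝ φ x v = 0
        have : fderiv ℝ φ x v = 0 := h0
        rw [this, mul_zero]))
  · simp only [ContinuousLinearMap.mul_apply']
    exact (hP.mul hφ.continuous).integrable_of_hasCompactSupport
      (hφc.mono (fun x hx => by intro h0; exact hx (by simp [h0])))

/-- **A Lipschitz potential for the `L^∞` field `(-f(u), u)` of a distributional solution.**
If `uₜ + f(u)ₓ = 0` in `𝒟'(Ω)` (i.e. the bounded field `(hₜ, hₓ) := (-f(u), u)` is curl free)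
and `closedBall p₀ (2R) ⊆ Ω` (sup-norm balls = squares), there is a bounded, globally Lipschitz
`h : ℝ² → ℝ` which at a.e. point of `ball p₀ (R/2)` is differentiable with `∂ₜh = -f(u)`,
`∂ₓh = u`. Construction: L-path potentials of the mollified fields, which converge uniformly by
the commuting-mollifier estimate `abs_sub_le_of_mollify_comm`; McShane extension and clamping;
identification of the gradient by integration by parts, Rademacher's theorem and the
du Bois-Reymond lemma. (De Lellis–Otto–Westdickenberg 2004, Thm 2.3: "if `h` is a function with
`hₜ = -f(u)` and `hₓ = u` …".) [folklore] -/
theorem exists_potential {Ω : Set (ℝ × ℝ)} {u : ℝ × ℝ → ℝ} (hu : Measurable u) {M : ℝ}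
    (huM : ∀ p, |u p| ≤ M) {f : ℝ → ℝ} (hf : Continuous f)
    (hws : ∀ φ : ℝ × ℝ → ℝ, ContDiff ℝ (⊤ : ℕ∞) φ → HasCompactSupport φ → tsupport φ ⊆ Ω →
      ∫ p in Ω, (u p * deriv (fun t => φ (t, p.2)) p.1
        + f (u p) * deriv (fun x => φ (p.1, x)) p.2) = 0)
    {p₀ : ℝ × ℝ} {R : ℝ} (hR : 0 < R) (hΩR : closedBall p₀ (2 * R) ⊆ Ω) :
    ∃ (h : ℝ × ℝ → ℝ) (K : ℝ≥0) (B : ℝ), LipschitzWith K h ∧ (∀ z, |h z| ≤ B) ∧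
      ∀ᵐ z ∂(volume : Measure (ℝ × ℝ)), z ∈ ball p₀ (R / 2) →
        DifferentiableAt ℝ h z ∧ fderiv ℝ h z (1, 0) = -f (u z) ∧ fderiv ℝ h z (0, 1) = u z := by
  obtain ⟨Mf, hMf⟩ := exists_abs_comp_le huM hf
  have hfu : Measurable fun z => f (u z) := hf.measurable.comp hu
  have hM0 : 0 ≤ M := (abs_nonneg _).trans (huM p₀)
  have hMf0 : 0 ≤ Mf := (abs_nonneg _).trans (hMf p₀)
  -- the bumps
  let ρs : ℕ → ContDiffBump (0 : ℝ × ℝ) := fun n =>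
    ⟨R / (8 * ((n : ℝ) + 2)), R / (4 * ((n : ℝ) + 2)), by positivity, by
      rw [div_lt_div_iff_of_pos_left hR (by positivity) (by positivity)]; nlinarith⟩
  have hrOut : ∀ n, (ρs n).rOut = R / (4 * ((n : ℝ) + 2)) := fun n => rfl
  have hrIn : ∀ n, (ρs n).rIn = R / (8 * ((n : ℝ) + 2)) := fun n => rfl
  have hr4 : ∀ n, (ρs n).rOut ≤ R / 4 := fun n => by
    rw [hrOut]
    exact div_le_div_of_nonneg_left hR.le (by positivity) (by nlinarith)
  have hrR : ∀ n, (ρs n).rOut ≤ R := fun n => (hr4 n).trans (by linarith)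
  have hr_anti : ∀ n N, N ≤ n → (ρs n).rOut ≤ (ρs N).rOut := fun n N h => by
    rw [hrOut, hrOut]
    apply div_le_div_of_nonneg_left hR.le (by positivity)
    have : (N : ℝ) ≤ n := by exact_mod_cast h
    nlinarith
  have hr_tend : Tendsto (fun n => (ρs n).rOut) atTop (𝓝 0) := by
    have h1 : Tendsto (fun n : ℕ => (R / 4) / ((n : ℝ) + 2)) atTop (𝓝 0) := by
      have := (tendsto_const_div_atTop_nhds_zero_nat (R / 4)).comp (tendsto_add_atTop_nat 2)
      refine this.congr (fun n => ?_)
      simp [Function.comp]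
    refine h1.congr (fun n => ?_)
    rw [hrOut]; field_simp
  have hr2 : ∀ n, (ρs n).rOut ≤ 2 * (ρs n).rIn := fun n => by
    rw [hrOut, hrIn]; apply le_of_eq; field_simp; ring
  -- the mollified fields
  set W₂ : ℕ → ℝ × ℝ → ℝ := fun n => (ρs n).normed volume ⋆[lsmul ℝ ℝ, volume] u with hW₂
  set F : ℕ → ℝ × ℝ → ℝ :=
    fun n => (ρs n).normed volume ⋆[lsmul ℝ ℝ, volume] (fun z => f (u z)) with hF
  set W₁ : ℕ → ℝ × ℝ → ℝ := fun n z => -(F n z) with hW₁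
  have hW₂s : ∀ n, ContDiff ℝ (⊤ : ℕ∞) (W₂ n) := fun n => contDiff_mollify (ρs n) hu huM
  have hFs : ∀ n, ContDiff ℝ (⊤ : ℕ∞) (F n) := fun n => contDiff_mollify (ρs n) hfu hMf
  have hW₁s : ∀ n, ContDiff ℝ (⊤ : ℕ∞) (W₁ n) := fun n => (hFs n).neg
  have hW₂b : ∀ n z, |W₂ n z| ≤ M := fun n z => abs_mollify_le (ρs n) huM z
  have hFb : ∀ n z, |F n z| ≤ Mf := fun n z => abs_mollify_le (ρs n) hMf z
  have hW₁b : ∀ n z, |W₁ n z| ≤ Mf := fun n z => by simp only [hW₁, abs_neg]; exact hFb n z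
  have hcurl : ∀ n, ∀ w ∈ ball p₀ R, fderiv ℝ (W₂ n) w (1, 0) = fderiv ℝ (W₁ n) w (0, 1) := by
    intro n w hw
    have hsub : closedBall w (ρs n).rOut ⊆ Ω := by
      refine subset_trans (fun y hy => ?_) hΩR
      rw [mem_closedBall] at hy ⊢
      have := (mem_ball.mp hw).le
      calc dist y p₀ ≤ dist y w + dist w p₀ := dist_triangle _ _ _
        _ ≤ 2 * R := by linarith [hrR n]
    have key := mollify_conservationLaw (ρs n) hu huM hf hws hsub
    have hneg : fderiv ℝ (W₁ n) w = -fderiv ℝ (F n) w :=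
      (((hFs n).differentiable (by simp)) w).hasFDerivAt.neg.fderiv
    rw [hneg, _root_.neg_apply]
    simp only [hW₂, hF] at key ⊢
    linarith
  -- the approximate potentials
  set P : ℕ → ℝ × ℝ → ℝ := fun n z =>
    (∫ y in p₀.2..z.2, W₂ n (z.1, y)) + ∫ s in p₀.1..z.1, W₁ n (s, p₀.2) with hP
  have hPc : ∀ n, Continuous (P n) := by
    intro n
    apply Continuous.add
    · exact intervalIntegral.continuous_parametric_intervalIntegral_of_continuous
        (f := fun (z : ℝ × ℝ) (y : ℝ) => W₂ n (z.1, y)) ((hW₂s n).continuous.comp (by fun_prop))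
        continuous_snd
    · exact intervalIntegral.continuous_parametric_intervalIntegral_of_continuous
        (f := fun (_ : ℝ × ℝ) (s : ℝ) => W₁ n (s, p₀.2)) ((hW₁s n).continuous.comp (by fun_prop))
        continuous_fst
  have hP1 : ∀ n, ∀ z ∈ ball p₀ R, HasLineDerivAt ℝ (P n) (W₁ n z) z (1, 0) := fun n z hz =>
    hasLineDerivAt_lpath_fst ((hW₁s n).of_le (by simp)) ((hW₂s n).of_le (by simp)) (hcurl n) hz
  have hP2 : ∀ n z, HasLineDerivAt ℝ (P n) (W₂ n z) z (0, 1) := fun n z =>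
    hasLineDerivAt_lpath_snd (hW₂s n).continuous p₀ z
  have hP0 : ∀ n, P n p₀ = 0 := fun n => by simp [hP, intervalIntegral.integral_same]
  -- commuting mollifications of the fields
  have hc1 : ∀ n m z, ((ρs m).normed volume ⋆[lsmul ℝ ℝ, volume] W₁ n) z
      = ((ρs n).normed volume ⋆[lsmul ℝ ℝ, volume] W₁ m) z := by
    intro n m z
    simp only [hW₁, hF]
    rw [mollify_neg, mollify_neg, mollify_comm (ρs n) (ρs m) hfu hMf z]
  have hc2 : ∀ n m z, ((ρs m).normed volume ⋆[lsmul ℝ ℝ, volume] W₂ n) z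
      = ((ρs n).normed volume ⋆[lsmul ℝ ℝ, volume] W₂ m) z := by
    intro n m z
    simp only [hW₂]
    exact mollify_comm (ρs n) (ρs m) hu huM z
  -- the Cauchy estimate
  have hcauchy : ∀ n m, ∀ z ∈ ball p₀ (R / 2),
      |P n z - P m z| ≤ 2 * (Mf + M) * ((ρs n).rOut + (ρs m).rOut) := by
    intro n m z hz
    exact abs_sub_le_of_mollify_comm (ρs n) (ρs m) (hPc n) (hPc m) (hW₁s n).continuous
      (hW₂s n).continuous (hW₁s m).continuous (hW₂s m).continuous hMf0 hM0
      (hP1 n) (fun z _ => hP2 n z) (hP1 m) (fun z _ => hP2 m z)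
      (hW₁b n) (hW₂b n) (hW₁b m) (hW₂b m) (hr4 n) (hr4 m)
      (fun z _ => hc1 n m z) (fun z _ => hc2 n m z) (hP0 n) (hP0 m) hz
  -- pointwise limit on the half-square
  have hconv : ∀ z ∈ ball p₀ (R / 2), ∃ L, Tendsto (fun n => P n z) atTop (𝓝 L) := by
    intro z hz
    apply cauchySeq_tendsto_of_complete
    apply cauchySeq_of_le_tendsto_0 (fun N => 4 * (Mf + M) * (ρs N).rOut)
    · intro n m N hn hm
      rw [Real.dist_eq]
      calc |P n z - P m z| ≤ 2 * (Mf + M) * ((ρs n).rOut + (ρs m).rOut) := hcauchy n m z hz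
        _ ≤ 4 * (Mf + M) * (ρs N).rOut := by
          nlinarith [hr_anti n N hn, hr_anti m N hm, add_nonneg hMf0 hM0]
    · have := hr_tend.const_mul (4 * (Mf + M))
      simpa using this
  choose! h₀ hh₀ using hconv
  have hrate : ∀ n, ∀ z ∈ ball p₀ (R / 2), |P n z - h₀ z| ≤ 2 * (Mf + M) * (ρs n).rOut := by
    intro n z hz
    have lim1 : Tendsto (fun m => |P n z - P m z|) atTop (𝓝 (|P n z - h₀ z|)) :=
      ((tendsto_const_nhds.sub (hh₀ z hz)).abs)
    have lim2 : Tendsto (fun m => 2 * (Mf + M) * ((ρs n).rOut + (ρs m).rOut)) atTop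
        (𝓝 (2 * (Mf + M) * ((ρs n).rOut + 0))) :=
      tendsto_const_nhds.mul (tendsto_const_nhds.add hr_tend)
    rw [add_zero] at lim2
    exact le_of_tendsto_of_tendsto' lim1 lim2 (fun m => hcauchy n m z hz)
  have hh₀0 : h₀ p₀ = 0 := by
    have := hh₀ p₀ (mem_ball_self (by linarith))
    simp only [hP0] at this
    exact tendsto_nhds_unique this tendsto_const_nhds
  -- Lipschitz estimate in the limit
  have hlipP : ∀ n, ∀ a ∈ ball p₀ R, ∀ b ∈ ball p₀ R,
      |P n a - P n b| ≤ (Mf + M) * dist a b := by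
    intro n a ha b hb
    have est := abs_sub_le_of_hasLineDerivAt (hP1 n) (fun z _ => hP2 n z) (fun z _ => hW₁b n z)
      (fun z _ => hW₂b n z) ha hb
    have d1 : |a.1 - b.1| ≤ dist a b := by rw [Prod.dist_eq, Real.dist_eq]; exact le_max_left _ _
    have d2 : |a.2 - b.2| ≤ dist a b := by
      rw [Prod.dist_eq, Real.dist_eq, Real.dist_eq]; exact le_max_right _ _
    nlinarith [mul_le_mul_of_nonneg_left d1 hMf0, mul_le_mul_of_nonneg_left d2 hM0]
  have hhalf : ball p₀ (R / 2) ⊆ ball p₀ R := ball_subset_ball (by linarith)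
  have hlip₀ : ∀ a ∈ ball p₀ (R / 2), ∀ b ∈ ball p₀ (R / 2),
      |h₀ a - h₀ b| ≤ (Mf + M) * dist a b := by
    intro a ha b hb
    have lim1 : Tendsto (fun n => |P n a - P n b|) atTop (𝓝 (|h₀ a - h₀ b|)) :=
      ((hh₀ a ha).sub (hh₀ b hb)).abs
    exact le_of_tendsto' lim1 (fun n => hlipP n a (hhalf ha) b (hhalf hb))
  have hLip : LipschitzOnWith (Real.toNNReal (Mf + M)) h₀ (ball p₀ (R / 2)) := by
    apply LipschitzOnWith.of_dist_le_mul
    intro a ha b hb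
    rw [Real.dist_eq, Real.coe_toNNReal _ (add_nonneg hMf0 hM0)]
    exact hlip₀ a ha b hb
  have hb₀ : ∀ z ∈ ball p₀ (R / 2), |h₀ z| ≤ (Mf + M) * R := by
    intro z hz
    have := hlip₀ z hz p₀ (mem_ball_self (by linarith))
    rw [hh₀0, sub_zero] at this
    have hd : dist z p₀ ≤ R := by have := (mem_ball.mp hz).le; linarith
    nlinarith [add_nonneg hMf0 hM0]
  -- extension and clamping
  obtain ⟨H₁, hH₁, hEq⟩ := hLip.extend_real
  set B₀ : ℝ := (Mf + M) * R with hB₀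
  have hB₀0 : 0 ≤ B₀ := by positivity
  set H : ℝ × ℝ → ℝ := fun z => max (-B₀) (min B₀ (H₁ z)) with hH
  have hHlip : LipschitzWith (Real.toNNReal (Mf + M)) H := (hH₁.const_min B₀).const_max (-B₀)
  have hHB : ∀ z, |H z| ≤ B₀ := fun z => by
    simp only [hH]
    rw [abs_le]
    exact ⟨le_max_left _ _, max_le (by linarith) (min_le_left _ _)⟩
  have hHeq : ∀ z ∈ ball p₀ (R / 2), H z = h₀ z := by
    intro z hz
    have e : H₁ z = h₀ z := (hEq hz).symm
    simp only [hH, e]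
    have := abs_le.mp (hb₀ z hz)
    rw [min_eq_right this.2, max_eq_right this.1]
  -- distributional identity for `H` on the half-square
  have hdist : ∀ (v : ℝ × ℝ) (w : ℝ × ℝ → ℝ) (Wn : ℕ → ℝ × ℝ → ℝ),
      (∀ n, Continuous (Wn n)) → (∀ n z, |Wn n z| ≤ Mf + M) →
      (∀ n, ∀ z ∈ ball p₀ R, HasLineDerivAt ℝ (P n) (Wn n z) z v) →
      (∀ᵐ z ∂(volume : Measure (ℝ × ℝ)), Tendsto (fun n => Wn n z) atTop (𝓝 (w z))) →
      ∀ φ : ℝ × ℝ → ℝ, ContDiff ℝ (⊤ : ℕ∞) φ → HasCompactSupport φ →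
        tsupport φ ⊆ ball p₀ (R / 2) →
        ∫ z, H z * fderiv ℝ φ z v = -∫ z, w z * φ z := by
    intro v w Wn hWc hWb hWl hwlim φ hφ hφc hφs
    have hφ1 : ContDiff ℝ 1 φ := hφ.of_le (by simp)
    have cφv : Continuous fun z => fderiv ℝ φ z v :=
      (hφ1.continuous_fderiv one_ne_zero).clm_apply continuous_const
    have idn : ∀ n, ∫ z, P n z * fderiv ℝ φ z v = -∫ z, Wn n z * φ z := fun n =>
      integral_mul_fderiv_eq_of_hasLineDerivAt (hPc n) (hWc n) hφ hφc
        (fun y hy => hWl n y (hhalf (hφs hy)))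
    have hφv0 : ∀ z ∉ tsupport φ, fderiv ℝ φ z v = 0 := fun z hz => by
      simp [fderiv_of_notMem_tsupport ℝ hz]
    have hφ0 : ∀ z ∉ tsupport φ, φ z = 0 := fun z hz => image_eq_zero_of_notMem_tsupport hz
    have limL : Tendsto (fun n => ∫ z, P n z * fderiv ℝ φ z v) atTop
        (𝓝 (∫ z, H z * fderiv ℝ φ z v)) := by
      refine tendsto_integral_of_dominated_convergence
        (fun z => (B₀ + 2 * (Mf + M) * R) * ‖fderiv ℝ φ z v‖) ?_ ?_ ?_ ?_
      · intro n; exact ((hPc n).mul cφv).aestronglyMeasurable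
      · exact (cφv.norm.const_mul _).integrable_of_hasCompactSupport
          (HasCompactSupport.of_support_subset_isCompact hφc (fun z hz => by
            by_contra h
            exact hz (by simp [hφv0 z h])))
      · intro n
        refine ae_of_all _ fun z => ?_
        by_cases hz : z ∈ tsupport φ
        · have hz' := hφs hz
          have h1 := hrate n z hz'
          have h2 := hb₀ z hz'
          have h3 : |P n z| ≤ |P n z - h₀ z| + |h₀ z| := by
            have := abs_add_le (P n z - h₀ z) (h₀ z); simpa using this
          have h4 : |P n z| ≤ B₀ + 2 * (Mf + M) * R := by
            nlinarith [hrR n, add_nonneg hMf0 hM0]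
          rw [norm_mul, Real.norm_eq_abs]
          exact mul_le_mul_of_nonneg_right h4 (norm_nonneg _)
        · rw [hφv0 z hz]; simp
      · refine ae_of_all _ fun z => ?_
        by_cases hz : z ∈ tsupport φ
        · rw [hHeq z (hφs hz)]
          exact (hh₀ z (hφs hz)).mul_const _
        · simp only [hφv0 z hz, mul_zero]
          exact tendsto_const_nhds
    have limR : Tendsto (fun n => -∫ z, Wn n z * φ z) atTop (𝓝 (-∫ z, w z * φ z)) := by
      refine (tendsto_integral_of_dominated_convergence (fun z => (Mf + M) * ‖φ z‖)
        ?_ ?_ ?_ ?_).neg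
      · intro n; exact ((hWc n).mul hφ.continuous).aestronglyMeasurable
      · exact (hφ.continuous.norm.const_mul _).integrable_of_hasCompactSupport
          (HasCompactSupport.of_support_subset_isCompact hφc (fun z hz => by
            by_contra h
            exact hz (by simp [hφ0 z h])))
      · intro n
        exact ae_of_all _ fun z => by
          rw [norm_mul, Real.norm_eq_abs]
          exact mul_le_mul_of_nonneg_right (hWb n z) (norm_nonneg _)
      · filter_upwards [hwlim] with z hz
        exact hz.mul_const _
    exact tendsto_nhds_unique limL (limR.congr (fun n => (idn n).symm))
  -- the two instances of the identity
  have hWlim₁ : ∀ᵐ z ∂(volume : Measure (ℝ × ℝ)),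
      Tendsto (fun n => W₁ n z) atTop (𝓝 (-f (u z))) := by
    filter_upwards [ae_tendsto_mollify hr_tend hr2 hfu hMf] with z hz
    simp only [hW₁, hF]
    exact hz.neg
  have hWlim₂ : ∀ᵐ z ∂(volume : Measure (ℝ × ℝ)), Tendsto (fun n => W₂ n z) atTop (𝓝 (u z)) := by
    filter_upwards [ae_tendsto_mollify hr_tend hr2 hu huM] with z hz
    simpa only [hW₂] using hz
  have hid₁ := hdist (1, 0) (fun z => -f (u z)) W₁ (fun n => (hW₁s n).continuous)
    (fun n z => (hW₁b n z).trans (by linarith)) hP1 hWlim₁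
  have hid₂ := hdist (0, 1) u W₂ (fun n => (hW₂s n).continuous)
    (fun n z => (hW₂b n z).trans (by linarith)) (fun n z _ => hP2 n z) hWlim₂
  -- Rademacher and du Bois-Reymond
  have hRad : ∀ᵐ z ∂(volume : Measure (ℝ × ℝ)), DifferentiableAt ℝ H z :=
    hHlip.ae_differentiableAt
  have hDBR : ∀ (v : ℝ × ℝ) (w : ℝ × ℝ → ℝ), Measurable w → (∀ z, |w z| ≤ Mf + M) →
      (∀ φ : ℝ × ℝ → ℝ, ContDiff ℝ (⊤ : ℕ∞) φ → HasCompactSupport φ →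
        tsupport φ ⊆ ball p₀ (R / 2) → ∫ z, H z * fderiv ℝ φ z v = -∫ z, w z * φ z) →
      ∀ᵐ z ∂(volume : Measure (ℝ × ℝ)), z ∈ ball p₀ (R / 2) → lineDeriv ℝ H z v = w z := by
    intro v w hwm hwb hid
    have hDm : Measurable fun z => lineDeriv ℝ H z v := measurable_lineDeriv hHlip.continuous
    have hDb : ∀ z, |lineDeriv ℝ H z v| ≤ (Mf + M).toNNReal * ‖v‖ := fun z => by
      simpa [Real.norm_eq_abs] using norm_lineDeriv_le_of_lipschitz ℝ hHlip (x₀ := z) (v := v)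
    have key := IsOpen.ae_eq_zero_of_integral_contDiff_smul_eq_zero (μ := volume)
      (isOpen_ball (x := p₀) (ε := R / 2)) (f := fun z => lineDeriv ℝ H z v - w z) ?_ ?_
    · filter_upwards [key] with z hz hzU
      linarith [hz hzU]
    · exact (((locallyIntegrable_of_abs_le hDm hDb).sub
        (locallyIntegrable_of_abs_le hwm hwb)).locallyIntegrableOn _)
    · intro g hg hgc hgs
      obtain ⟨D, hD⟩ := ContDiff.lipschitzWith_of_hasCompactSupport hgc hg (by simp)
      have ibp := hHlip.integral_lineDeriv_mul_eq (μ := volume) hD hgc v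
      have e1 : ∀ z, lineDeriv ℝ g z (-v) = -(fderiv ℝ g z v) := fun z => by
        rw [((hg.differentiable (by simp)) z).lineDeriv_eq_fderiv, map_neg]
      simp_rw [e1] at ibp
      have e2 : ∫ z, -(fderiv ℝ g z v) * H z = -∫ z, H z * fderiv ℝ g z v := by
        rw [← integral_neg]; congr 1; funext z; ring
      rw [e2, hid g hg hgc hgs, neg_neg] at ibp
      have i1 : Integrable (fun z => g z * lineDeriv ℝ H z v) volume :=
        integrable_mul_of_abs_le hDm hDb hg.continuous hgc
      have i2 : Integrable (fun z => g z * w z) volume :=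
        integrable_mul_of_abs_le hwm hwb hg.continuous hgc
      simp_rw [smul_eq_mul, mul_sub]
      rw [integral_sub i1 i2]
      have e3 : ∫ z, g z * lineDeriv ℝ H z v = ∫ z, lineDeriv ℝ H z v * g z := by
        congr 1; funext z; ring
      have e4 : ∫ z, g z * w z = ∫ z, w z * g z := by congr 1; funext z; ring
      rw [e3, e4, ibp, sub_self]
  have a1 := hDBR (1, 0) (fun z => -f (u z)) hfu.neg
    (fun z => by rw [abs_neg]; exact (hMf z).trans (by linarith)) hid₁
  have a2 := hDBR (0, 1) u hu (fun z => (huM z).trans (by linarith)) hid₂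
  refine ⟨H, _, B₀, hHlip, hHB, ?_⟩
  filter_upwards [hRad, a1, a2] with z hd h1 h2 hz
  exact ⟨hd, by rw [← hd.lineDeriv_eq_fderiv, h1 hz], by rw [← hd.lineDeriv_eq_fderiv, h2 hz]⟩

end PotentialConstruction

end Literature.Analysis.PDE.SingleEntropy
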